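import Summits.Parity.GeneralizedHardyLittlewood.Theorems.LeeYangFibresCellParityLawKernelInductionFibres
import HarnessLib

/-!
# Route `LeeYangFibres`, crux `CellParityLaw` (stmt-Parity-14109), line `section-annihilator`:
# the induction step `Q(1) ∧ Q(n) ⟹ Q(n+1)` — ranges of the fibre data (`stub_fibreRanges`, S1)

In the induction step (`stub_inductionStep`, skeleton v19, `n ≥ 2`) the parent cell `C_{n+1}(𝒜; x, z)` is the
sum over the primes `z < p ≤ x^{1/(n+1)}` of the fibres' cells `C_n(𝒜_p; x/p, p − 1/2)`, and the induction
hypothesis is applied to the fibre at scale `x_p = x/p`, threshold `z_p = p − 1/2`, deficit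
`η_p = η log x/log(x/p)` (so that `x_p^{η_p} = x^η`), with the same `Λ`, `w₀`. This file collects the
elementary range facts about that data which the assembly needs, for `u ≥ 2`, `n ≥ 2`,
`x ≥ exp(4(u+1)²)`, `x^{1/(u+1)} ≤ z < p ≤ x^{1/(n+1)}`, parent parameters in `KernelRanges x η Λ w₀ η₀` and any
`η' ≥ (3/2) η₀`:

* `2 ≤ p`, `p² ≤ x`, `p ≤ x^{1/3} ≤ x^{1/2}`, `x^{1/2} ≤ x/p`, `exp(2(u+1)²) ≤ x/p`;
* `x_p^{1/(u+1)} ≤ p − 1/2 ≤ x_p^{1/2}` (`FibreDataAux.fibre_threshold_range`, whose size hypothesis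
  `2^{(u+1)²+(u+1)} ≤ x` follows from `exp(4(u+1)²) ≤ x` since `2 ≤ e` and `(u+1)²+(u+1) ≤ 4(u+1)²`);
* `KernelRanges x_p η_p Λ w₀ η'`, `0 < η_p ≤ (3/2) η` (`FibreDataAux.fibre_eta_bounds`, `fibre_rpow_eta`);
* `1 ≤ u_p ≤ u_p^s ≤ u + 1` and `u_p^s − u_p ≤ 4 u_p^s/p` for `u_p = log(x/p)/log p`,
  `u_p^s = log(x/p)/log(p − 1/2)` (`FibreDataAux.shift_bounds`; the bound `u_p^s ≤ u + 1` is new: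
  `log(x/p) < u log p` because `log x ≤ (u+1) log z < (u+1) log p`, and
  `u log p ≤ (u+1) log(p − 1/2)` because `log p − log(p − 1/2) ≤ 1/2` while `log(p − 1/2) ≥ 4(u+1) − 1/2`).

References: E. Bombieri, RIMS Kôkyûroku 294 (1977) [BombieriRIMS1977].
-/

noncomputable section

open scoped BigOperators Classical
open Finset Literature.NumberTheory.Sieve

namespace Summit.Parity.GeneralizedHardyLittlewood.Cruxes.CellParityLaw.SectionAnnihilator

namespace InductionStepAux

namespace FibreRangesAux

/-- `2^{(u+1)²+(u+1)} ≤ exp(4(u+1)²)`: `2 ≤ e` and `(u+1)² + (u+1) ≤ 4(u+1)²`. [folklore] -/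
theorem two_pow_le_exp (u : ℕ) :
    (2 : ℝ) ^ ((u + 1) ^ 2 + (u + 1)) ≤ Real.exp (4 * ((u : ℝ) + 1) ^ 2) := by
  have h2e : (2 : ℝ) ≤ Real.exp 1 := by
    have h := Real.add_one_le_exp (1 : ℝ)
    norm_num at h
    exact h
  have hu0 : (0 : ℝ) ≤ u := Nat.cast_nonneg u
  calc (2 : ℝ) ^ ((u + 1) ^ 2 + (u + 1)) ≤ (Real.exp 1) ^ ((u + 1) ^ 2 + (u + 1)) :=
        pow_le_pow_left₀ (by norm_num) h2e _
    _ = Real.exp (((u + 1) ^ 2 + (u + 1) : ℕ) : ℝ) := Real.exp_one_pow _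
    _ ≤ Real.exp (4 * ((u : ℝ) + 1) ^ 2) := Real.exp_le_exp.mpr (by push_cast; nlinarith)

/-- `log p − log(p − 1/2) ≤ 1/2` for `p ≥ 2` (`log t ≤ t − 1` at `t = p/(p − 1/2)`). [folklore] -/
theorem log_sub_log_sub_half_le {p : ℝ} (hp2 : 2 ≤ p) :
    Real.log p - Real.log (p - 1 / 2) ≤ 1 / 2 := by
  have hp0 : 0 < p := by linarith
  have hph : 0 < p - 1 / 2 := by linarith
  have h := Real.log_le_sub_one_of_pos (div_pos hp0 hph)
  rw [Real.log_div hp0.ne' hph.ne'] at h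
  have e : p / (p - 1 / 2) - 1 = (1 / 2) / (p - 1 / 2) := by
    rw [div_sub_one hph.ne']
    congr 1
    ring
  rw [e] at h
  calc Real.log p - Real.log (p - 1 / 2) ≤ 1 / 2 / (p - 1 / 2) := h
    _ ≤ 1 / 2 := by
        rw [div_le_iff₀ hph]
        linarith

/-- **`u_p^s ≤ u + 1`**: for `x ≥ exp(4(u+1)²)`, `x^{1/(u+1)} ≤ z < p`, `p ≥ 2`,
`log(x/p)/log(p − 1/2) ≤ u + 1`. [`log(x/p) = log x − log p < (u+1) log p − log p = u log p`, and
`u log p ≤ (u+1) log(p − 1/2)` since `u (log p − log(p − 1/2)) ≤ u/2 ≤ 4(u+1) − 1/2 ≤ log(p − 1/2)`.] -/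
theorem us_le {u : ℕ} {x z p : ℝ} (hx : Real.exp (4 * ((u : ℝ) + 1) ^ 2) ≤ x)
    (hz : x ^ (1 / ((u : ℝ) + 1)) ≤ z) (hzp : z < p) (hp2 : 2 ≤ p) :
    Real.log (x / p) / Real.log (p - 1 / 2) ≤ (u : ℝ) + 1 := by
  have hx0 : 0 < x := (Real.exp_pos _).trans_le hx
  have hu0 : (0 : ℝ) ≤ u := Nat.cast_nonneg u
  have hu1 : (0 : ℝ) < (u : ℝ) + 1 := by positivity
  have hlx : 4 * ((u : ℝ) + 1) ^ 2 ≤ Real.log x := by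
    rw [Real.le_log_iff_exp_le hx0]
    exact hx
  have hz0 : 0 < z := (Real.rpow_pos_of_pos hx0 _).trans_le hz
  have hp0 : 0 < p := by linarith
  -- `log x ≤ (u+1) log z`
  have hlz : Real.log x ≤ ((u : ℝ) + 1) * Real.log z := by
    have h := Real.log_le_log (Real.rpow_pos_of_pos hx0 _) hz
    rw [Real.log_rpow hx0] at h
    have e : ((u : ℝ) + 1) * (1 / ((u : ℝ) + 1) * Real.log x) = Real.log x := by
      field_simp
    calc Real.log x = ((u : ℝ) + 1) * (1 / ((u : ℝ) + 1) * Real.log x) := e.symm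
      _ ≤ ((u : ℝ) + 1) * Real.log z := mul_le_mul_of_nonneg_left h hu1.le
  have hlzp : Real.log z < Real.log p := Real.log_lt_log hz0 hzp
  -- `log p ≥ 4(u+1)`
  have hlp4 : 4 * ((u : ℝ) + 1) ≤ Real.log p := by
    -- `(u+1) · 4(u+1) ≤ log x ≤ (u+1) log z < (u+1) log p`
    have h1 : ((u : ℝ) + 1) * (4 * ((u : ℝ) + 1)) ≤ ((u : ℝ) + 1) * Real.log p := by nlinarith
    exact le_of_mul_le_mul_left h1 hu1
  -- `log(x/p) ≤ u log p`
  have h1 : Real.log (x / p) ≤ u * Real.log p := by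
    rw [Real.log_div hx0.ne' hp0.ne']
    nlinarith
  -- `log p − log(p − 1/2) ≤ 1/2`
  have hdiff := log_sub_log_sub_half_le hp2
  have hlph : 0 < Real.log (p - 1 / 2) := Real.log_pos (by linarith)
  rw [div_le_iff₀ hlph]
  have h2 : (u : ℝ) * (Real.log p - Real.log (p - 1 / 2)) ≤ (u : ℝ) * (1 / 2) :=
    mul_le_mul_of_nonneg_left hdiff hu0
  nlinarith

end FibreRangesAux

/-- **`stub_fibreRanges`** (S1, registered sub-goal of `stub_inductionStep`, skeleton v19, line
`section-annihilator`): the ranges of the fibre data of the induction step. For `u ≥ 2`, `n ≥ 2`,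
`x ≥ exp(4(u+1)²)`, `x^{1/(u+1)} ≤ z < p ≤ x^{1/(n+1)}` (`p` prime), parent parameters in
`KernelRanges x η Λ w₀ η₀` and `η' ≥ (3/2) η₀`: `2 ≤ p`, `p² ≤ x`, `p ≤ x^{1/3}`, `p ≤ x^{1/2}`,
`x^{1/2} ≤ x/p`, `exp(2(u+1)²) ≤ x/p`, `(x/p)^{1/(u+1)} ≤ p − 1/2 ≤ (x/p)^{1/2}`,
`KernelRanges (x/p) η_p Λ w₀ η'` with `η_p = η log x/log(x/p)`, `0 < η_p ≤ (3/2) η`,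
`1 ≤ u_p ≤ u_p^s ≤ u + 1` and `u_p^s − u_p ≤ 4 u_p^s/p` (`u_p = log(x/p)/log p`,
`u_p^s = log(x/p)/log(p − 1/2)`). -/
theorem stub_fibreRanges : ∀ (u n : ℕ) (x z η Λ w₀ η₀ η' : ℝ) (p : ℕ), 2 ≤ u → 2 ≤ n →
    Real.exp (4 * ((u : ℝ) + 1) ^ 2) ≤ x → x ^ (1 / ((u : ℝ) + 1)) ≤ z →
    KernelRanges x η Λ w₀ η₀ → 3 / 2 * η₀ ≤ η' →
    p.Prime → z < (p : ℝ) → (p : ℝ) ≤ x ^ (1 / ((n : ℝ) + 1)) →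
      2 ≤ (p : ℝ) ∧ (p : ℝ) ^ 2 ≤ x ∧ (p : ℝ) ≤ x ^ (1 / 3 : ℝ) ∧ (p : ℝ) ≤ x ^ (1 / 2 : ℝ) ∧
      x ^ (1 / 2 : ℝ) ≤ x / p ∧ Real.exp (2 * ((u : ℝ) + 1) ^ 2) ≤ x / p ∧
      (x / p) ^ (1 / ((u : ℝ) + 1)) ≤ (p : ℝ) - 1 / 2 ∧ (p : ℝ) - 1 / 2 ≤ (x / p) ^ (1 / 2 : ℝ) ∧
      KernelRanges (x / p) (η * Real.log x / Real.log (x / p)) Λ w₀ η' ∧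
      0 < η * Real.log x / Real.log (x / p) ∧ η * Real.log x / Real.log (x / p) ≤ 3 / 2 * η ∧
      1 ≤ Real.log (x / p) / Real.log p ∧
      Real.log (x / p) / Real.log p ≤ Real.log (x / p) / Real.log ((p : ℝ) - 1 / 2) ∧
      Real.log (x / p) / Real.log ((p : ℝ) - 1 / 2) ≤ (u : ℝ) + 1 ∧
      Real.log (x / p) / Real.log ((p : ℝ) - 1 / 2) - Real.log (x / p) / Real.log p ≤
        4 * (Real.log (x / p) / Real.log ((p : ℝ) - 1 / 2)) / p := by
  intro u n x z η Λ w₀ η₀ η' p hu hn hx hz hKR hη' hpp hzp hpx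
  obtain ⟨hηlo, hηhi, hΛ1, hΛhi, hw₀2, hw₀hi⟩ := hKR
  /- 1. the scale `x` -/
  have hx0 : 0 < x := (Real.exp_pos _).trans_le hx
  have hu0 : (0 : ℝ) ≤ u := Nat.cast_nonneg u
  have hlx : 4 * ((u : ℝ) + 1) ^ 2 ≤ Real.log x := by
    rw [Real.le_log_iff_exp_le hx0]
    exact hx
  have hlx0 : 0 < Real.log x := by nlinarith
  have hx1 : 1 < x := (Real.log_pos_iff hx0.le).mp hlx0
  /- 2. the prime `p`: `2 ≤ p ≤ x^{1/(n+1)} ≤ x^{1/3} ≤ x^{1/2}`, `p² ≤ x`, `x^{1/2} ≤ x/p`, `p < x` -/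
  have hp2 : 2 ≤ (p : ℝ) := by exact_mod_cast hpp.two_le
  have hp0 : 0 < (p : ℝ) := by linarith
  have hp1 : 1 < (p : ℝ) := by linarith
  have hn1 : (0 : ℝ) < (n : ℝ) + 1 := by positivity
  have hp3 : (p : ℝ) ≤ x ^ (1 / 3 : ℝ) := by
    refine hpx.trans (Real.rpow_le_rpow_of_exponent_le hx1.le ?_)
    rw [div_le_div_iff₀ hn1 (by norm_num)]
    have : (2 : ℝ) ≤ n := by exact_mod_cast hn
    linarith
  have hp12 : (p : ℝ) ≤ x ^ (1 / 2 : ℝ) :=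
    hp3.trans (Real.rpow_le_rpow_of_exponent_le hx1.le (by norm_num))
  have hsqx : x ^ (1 / 2 : ℝ) * x ^ (1 / 2 : ℝ) = x := by
    rw [← Real.rpow_add hx0]
    norm_num
  have hxh0 : 0 ≤ x ^ (1 / 2 : ℝ) := (Real.rpow_pos_of_pos hx0 _).le
  have hpsq : (p : ℝ) ^ 2 ≤ x := by
    calc (p : ℝ) ^ 2 = (p : ℝ) * p := sq _
      _ ≤ x ^ (1 / 2 : ℝ) * x ^ (1 / 2 : ℝ) := mul_le_mul hp12 hp12 hp0.le hxh0
      _ = x := hsqx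
  have hxhalf : x ^ (1 / 2 : ℝ) ≤ x / p := by
    rw [le_div_iff₀ hp0]
    calc x ^ (1 / 2 : ℝ) * p ≤ x ^ (1 / 2 : ℝ) * x ^ (1 / 2 : ℝ) := mul_le_mul_of_nonneg_left hp12 hxh0
      _ = x := hsqx
  have hpx' : (p : ℝ) < x := by
    calc (p : ℝ) ≤ x ^ (1 / 3 : ℝ) := hp3
      _ < x ^ (1 : ℝ) := Real.rpow_lt_rpow_of_exponent_lt hx1 (by norm_num)
      _ = x := Real.rpow_one x
  /- 3. `exp(2(u+1)²) ≤ x^{1/2} ≤ x/p` -/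
  have hexp : Real.exp (2 * ((u : ℝ) + 1) ^ 2) ≤ x / p := by
    refine le_trans ?_ hxhalf
    rw [← Real.sqrt_eq_rpow]
    apply Real.le_sqrt_of_sq_le
    have e : Real.exp (2 * ((u : ℝ) + 1) ^ 2) ^ 2 = Real.exp (4 * ((u : ℝ) + 1) ^ 2) := by
      rw [sq, ← Real.exp_add]
      congr 1
      ring
    rw [e]
    exact hx
  /- 4. the thresholds of the fibre -/
  have h2x : (2 : ℝ) ^ ((u + 1) ^ 2 + (u + 1)) ≤ x := (FibreRangesAux.two_pow_le_exp u).trans hx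
  obtain ⟨hth1, hth2⟩ := FibreDataAux.fibre_threshold_range hu hn h2x hz hzp hpx hp2
  /- 5. the deficit `η_p` and the fibre's `KernelRanges` -/
  have hη0 : 0 < η := (Real.rpow_pos_of_pos hlx0 _).trans_le hηlo
  obtain ⟨-, hηp32, hηplo⟩ := FibreDataAux.fibre_eta_bounds hx1 hp1 hp3 hη0.le hηlo
  have hl0 : 0 < Real.log (x / p) := Real.log_pos ((one_lt_div hp0).mpr hpx')
  have hηp0 : 0 < η * Real.log x / Real.log (x / p) := div_pos (mul_pos hη0 hlx0) hl0
  have hrpow := FibreDataAux.fibre_rpow_eta (η := η) hx0 hp0 hpx'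
  have hKRp : KernelRanges (x / p) (η * Real.log x / Real.log (x / p)) Λ w₀ η' := by
    refine ⟨hηplo, ?_, hΛ1, ?_, hw₀2, ?_⟩
    · linarith
    · rw [hrpow]
      exact hΛhi
    · rw [hrpow]
      exact hw₀hi
  /- 6. the roughness parameters `u_p`, `u_p^s` -/
  obtain ⟨huu1, huus, hshift⟩ := FibreDataAux.shift_bounds hp2 hpsq
  have hus : Real.log (x / p) / Real.log ((p : ℝ) - 1 / 2) ≤ (u : ℝ) + 1 :=
    FibreRangesAux.us_le hx hz hzp hp2
  exact ⟨hp2, hpsq, hp3, hp12, hxhalf, hexp, hth1, hth2, hKRp, hηp0, hηp32, huu1, huus, hus, hshift⟩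

end InductionStepAux

end Summit.Parity.GeneralizedHardyLittlewood.Cruxes.CellParityLaw.SectionAnnihilator

end
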